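import Summits.ValiantsHypothesis.ValiantsHypothesis.Theorems.TwoProducts.RankTwoJacobianTowerInduction
import Summits.ValiantsHypothesis.ValiantsHypothesis.Theorems.TwoProducts.RankThreeWronskianTransfer

/-!
# Rank-two Jacobian ENGINE, shifted (part 1 of 2): the SHIFTED AXIAL TRANSFER `G·J(F,v) − F·J(G,v)`

ENGINE (FILE A) of the located instance T1-A′ (FERMAT TRINOMIAL `w₀^a + λ·w₁^b − κ·w₂^d`) of the OPEN rung 3-AFF of the SIDE ladder
«table-rank-ladder» of crux `stmt-ValiantsHypothesis-5906` (`TwoProducts`), priced by val-idea-crit-8 g4 VERDICT #66 (route) / #68 (split of record: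
FILE A = this file + its part 2 `…RankTwoJacobianShiftedSpecials` (the 400-line lint), val-port-1 g5; FILE B = `Theorems/TwoProducts/RankThreeAffineTrinomial.lean`,
the client).  THIS PART: `OnLineShift`, `IsSpecialShift`, the typed `ShiftedAxialTransfer` and its proof ★★ `shiftedAxialTransfer`; PART 2: the cells, the
shift-special set `SpecShift` with ★ `card_SpecShift_le`, and the one-call template ★ `Eset_subset_of_shifted` for FILE B.

CONTENT.  ✓ `axialTransfer` (`…RankTwoJacobianAxial`, val-idea-35 g9 / val-lit-p3 g18) says: if `e` is the axial lead of the carrier `v` at `ν` and `ν` is an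
edge direction of `F ≠ 0`, then `ν` is `e`-special for `F` or an edge direction of `J(F,v)`.  Here the SAME statement one derivation deeper: for any
second polynomial `G` with a unique `ν`-top `g`, `ν` is `(e,g)`-SHIFT-special for `F` (its top set is two points, one on the shifted axis `g + ℝ·e`) or an
edge direction of the Wronskian-type combination `G·J(F,v) − F·J(G,v)`.  Proof = ✓ `axialTransfer`'s verbatim with `det(γ,e) ↦ det(γ,e) − det(g,e)`:
above a top point `γ₀` of `F` the coefficient of `X^{γ₀+g+e}` in `G·J(F,v) − F·J(G,v)` is `F_{γ₀}·G_g·v_e·(det(γ₀,e) − det(g,e))` (`coeff_shift_top`) and every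
weight on the support is `≤ wt γ₀ + wt g + wt e` (`wt_le_of_mem_support_shift`); two top points of equal weight on the shifted axis coincide because
`⟨ν,e⟩ ≠ 0` (`onLineShift_unique`).  `G = 1, g = 0` recovers ✓ `AxialTransfer` (`axialTransfer_of_shifted`, sanity).
In FILE B it is applied with `F := E₂ = w₀w₁·J(N′,w₂)`, `G := β = b·w₀·J(w₁,w₂)`, `v := w₁` (crit-8 #66 (ii)–(iii)).

Vocabulary BY IMPORT, nothing restated: `Poly2`/`jac`/`idet`/`OnAxis`/`IsAxialLead`/`IsSpecial`/`wt`/`IsEdgeDir` (✓ `…RankTwoJacobian{,Ostrowski,Axial}`),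
`Expo`/`TieIn`/`wt_le_of_mem_support_mul` etc. (✓ `…RankTwoJacobianTower{Charts,Exceptional,Specials,Induction}`), and the ONE polynomial-level
`IsUniqueTop ν (w : Poly2) p` of ✓ `…RankThreeWronskianTransfer` (l.30; it agrees definitionally with `IsUTop ν w.support p`; `IsUniqueTop.le/.eq_of_le`).
HONEST LABEL: helper ENGINE for a side-ladder located instance of the OPEN rung 3-AFF (`…Cruxes.TwoProducts.ValIdea35g10.RankThreeAffineLaw`); NOT γ;
nothing here closes 5906 / `PlanarCellBound` / `ResidualLawV25`; `TwoProducts` OPEN; 0 summit distance; VP ≠ VNP is NOT proved here or anywhere in this tree.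
`--supports stmt-ValiantsHypothesis-5906 --as helper` (val-port-1 g5; critic of record val-idea-crit-8 g4).  No instances, no notation, no named facts. [folklore]
-/

noncomputable section
set_option linter.dupNamespace false

namespace Summit.ValiantsHypothesis.ValiantsHypothesis.Theorems.TwoProducts.RankTwoJacobian

open scoped BigOperators Pointwise
open MvPolynomial

section TowerKernel
open scoped Classical

/-! ### §1 The shifted axis, shift-special directions, the typed transfer -/

/-- `p` lies on the SHIFTED AXIS `g + ℝ·e`: `det(p,e) = det(g,e)` — stated in `ℤ` through ✓ `idet` (no `ℕ`-subtraction, no `p − g`);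
`g = 0` is ✓ `OnAxis` (`onLineShift_zero_iff`). [folklore] -/
def OnLineShift (p g e : Expo) : Prop := idet p e = idet g e

/-- `OnLineShift p 0 e ↔ OnAxis p e`. [folklore] -/
theorem onLineShift_zero_iff (p e : Expo) : OnLineShift p 0 e ↔ OnAxis p e := by
  unfold OnLineShift
  rw [onAxis_iff_idet]
  have h0 : idet 0 e = 0 := by simp [idet]
  rw [h0]

/-- `ν` is `(e,g)`-SHIFT-SPECIAL for `F`: the `ν`-top set of `supp F` is exactly two points, one of them on the shifted axis `g + ℝ·e`
(✓ `IsSpecial` with `OnAxis · e` replaced by `OnLineShift · g e`; `g = 0` recovers `IsSpecial`, `isSpecialShift_zero_iff`). -/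
def IsSpecialShift (ν : Fin 2 → ℝ) (F : Poly2) (e g : Expo) : Prop :=
  ∃ p ∈ F.support, ∃ q ∈ F.support, p ≠ q ∧ (∀ r ∈ F.support, wt ν r ≤ wt ν p) ∧ wt ν q = wt ν p ∧
    (∀ r ∈ F.support, wt ν r = wt ν p → r = p ∨ r = q) ∧ (OnLineShift p g e ∨ OnLineShift q g e)

/-- `IsSpecialShift ν F e 0 ↔ IsSpecial ν F e` (sanity: the unshifted notion is the case `g = 0`). [folklore] -/
theorem isSpecialShift_zero_iff (ν : Fin 2 → ℝ) (F : Poly2) (e : Expo) : IsSpecialShift ν F e 0 ↔ IsSpecial ν F e := by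
  unfold IsSpecialShift IsSpecial
  simp only [onLineShift_zero_iff]

/-- A shift-special direction is a tie. [folklore] -/
theorem specialShift_tie {ν : Fin 2 → ℝ} {F : Poly2} {e g : Expo} (h : IsSpecialShift ν F e g) : TieIn ν F.support := by
  obtain ⟨p, hp, q, hq, hpq, hmax, hqp, -, -⟩ := h
  exact ⟨p, hp, q, hq, hpq, hmax, hqp⟩

/-- In a shift-special direction one of the two top points lies on the shifted axis. [folklore] -/
theorem specialShift_line_top {ν : Fin 2 → ℝ} {F : Poly2} {e g : Expo} (h : IsSpecialShift ν F e g) :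
    ∃ a ∈ F.support, OnLineShift a g e ∧ ∀ r ∈ F.support, wt ν r ≤ wt ν a := by
  obtain ⟨p, hp, q, hq, _, hmax, hqp, -, hax⟩ := h
  rcases hax with ha | ha
  · exact ⟨p, hp, ha, hmax⟩
  · exact ⟨q, hq, ha, fun r hr => hqp ▸ hmax r hr⟩

/-- SHIFTED AXIAL TRANSFER (typed; PROVED below as `shiftedAxialTransfer`; crit-8 g4 #66/#68 verbatim): if `e` is the axial lead of `v` at `ν`,
`g` the unique `ν`-top of `G`, and `ν` an edge direction of `F ≠ 0`, then `ν` is `(e,g)`-shift-special for `F` or an edge direction of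
`G·J(F,v) − F·J(G,v)`. -/
def ShiftedAxialTransfer : Prop :=
  ∀ (ν : Fin 2 → ℝ) (F G v : Poly2) (e g : Expo),
    F ≠ 0 → IsAxialLead ν v e → IsUniqueTop ν G g → IsEdgeDir ν F →
      IsSpecialShift ν F e g ∨ IsEdgeDir ν (G * jac F v - F * jac G v)

/-! ### §2 Kernel: weights and the top coefficient of `G·J(F,v) − F·J(G,v)` -/

/-- Support points of `J(A,v)` are `γ + s` with `s` a NON-ZERO exponent of `v`, hence `wt s ≤ wt e` for the axial lead `e`. [folklore] -/
theorem mem_support_jac_lead {ν : Fin 2 → ℝ} {v : Poly2} {e : Expo} (hlead : IsAxialLead ν v e) (A : Poly2)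
    {b : Expo} (hb : b ∈ (jac A v).support) :
    ∃ γ ∈ A.support, ∃ s ∈ v.support, γ + s = b ∧ s ≠ 0 ∧ wt ν s ≤ wt ν e := by
  obtain ⟨γ, hγ, s, hs, hγs, hdet⟩ := exists_of_mem_support_jac A v b hb
  have hs0 : s ≠ 0 := by rintro rfl; exact hdet (idet_zero_right γ)
  refine ⟨γ, hγ, s, hs, hγs, hs0, ?_⟩
  by_cases hse : s = e
  · rw [hse]
  · exact le_of_lt (hlead.2.2.2 s hs hs0 hse)

/-- Weights on `supp J(A,v)` are `≤ (top weight of A) + wt e`. [folklore] -/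
theorem wt_le_of_mem_support_jac_lead {ν : Fin 2 → ℝ} {v : Poly2} {e : Expo} (hlead : IsAxialLead ν v e) (A : Poly2) (M : ℝ)
    (hA : ∀ x ∈ A.support, wt ν x ≤ M) : ∀ b ∈ (jac A v).support, wt ν b ≤ M + wt ν e := by
  intro b hb
  obtain ⟨γ, hγ, s, -, rfl, -, hws⟩ := mem_support_jac_lead hlead A hb
  rw [wt_add]
  linarith [hA γ hγ]
/-- A support point of `J(G,v)` of the maximal weight `wt g + wt e` IS `g + e` (`g` the unique top of `G`, `e` the axial lead of `v`). [folklore] -/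
theorem eq_of_mem_support_jac_top {ν : Fin 2 → ℝ} {v G : Poly2} {e g : Expo} (hlead : IsAxialLead ν v e) (hG : IsUniqueTop ν G g)
    {b : Expo} (hb : b ∈ (jac G v).support) (hw : wt ν g + wt ν e ≤ wt ν b) : b = g + e := by
  obtain ⟨γ, hγ, s, hs, rfl, hs0, hws⟩ := mem_support_jac_lead hlead G hb
  rw [wt_add] at hw
  have hγle := hG.le γ hγ
  have hγg : γ = g := hG.eq_of_le hγ (by linarith)
  have hse : s = e := by
    by_contra hse
    have := hlead.2.2.2 s hs hs0 hse
    linarith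
  rw [hγg, hse]

/-- All weights on `supp (G·J(F,v) − F·J(G,v))` are `≤ wt γ₀ + wt g + wt e` (`γ₀` a top point of `F`). -/
theorem wt_le_of_mem_support_shift {ν : Fin 2 → ℝ} {F G v : Poly2} {e g γ₀ : Expo} (hlead : IsAxialLead ν v e)
    (hG : IsUniqueTop ν G g) (htop : ∀ r ∈ F.support, wt ν r ≤ wt ν γ₀) :
    ∀ r ∈ (G * jac F v - F * jac G v).support, wt ν r ≤ wt ν γ₀ + wt ν g + wt ν e := by
  intro r hr
  rcases Finset.mem_union.mp ((MvPolynomial.support_sub ..) hr) with hA | hB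
  · have := wt_le_of_mem_support_mul ν G (jac F v) (wt ν g) (wt ν γ₀ + wt ν e) hG.le
      (wt_le_of_mem_support_jac_lead hlead F (wt ν γ₀) htop) r hA
    linarith
  · have := wt_le_of_mem_support_mul ν F (jac G v) (wt ν γ₀) (wt ν g + wt ν e) htop
      (wt_le_of_mem_support_jac_lead hlead G (wt ν g) hG.le) r hB
    linarith

/-- **TOP COEFFICIENT FORMULA.** Above a top point `γ₀` of `F`, the coefficient of `X^{γ₀+g+e}` in `G·J(F,v) − F·J(G,v)` is
`F_{γ₀}·G_g·v_e·(det(γ₀,e) − det(g,e))` — it vanishes iff `γ₀` lies on the shifted axis `g + ℝ·e`. -/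
theorem coeff_shift_top {ν : Fin 2 → ℝ} {F G v : Poly2} {e g γ₀ : Expo} (hlead : IsAxialLead ν v e)
    (hG : IsUniqueTop ν G g) (hγ₀ : γ₀ ∈ F.support) (htop : ∀ r ∈ F.support, wt ν r ≤ wt ν γ₀) :
    coeff (γ₀ + g + e) (G * jac F v - F * jac G v) =
      coeff γ₀ F * coeff g G * coeff e v * (((idet γ₀ e - idet g e : ℤ)) : ℂ) := by
  have hA : coeff (γ₀ + g + e) (G * jac F v) = coeff g G * (coeff γ₀ F * coeff e v * ((idet γ₀ e : ℤ) : ℂ)) := by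
    rw [show γ₀ + g + e = g + (γ₀ + e) by rw [add_comm γ₀ g, add_assoc]]
    rw [coeff_mul_of_unique G (jac F v) g (γ₀ + e) ?_, coeff_jac_top ν F v e γ₀ hlead hγ₀ htop]
    intro a ha b hb hab
    have hwa := hG.le a ha
    have hwb := wt_le_of_mem_support_jac_lead hlead F (wt ν γ₀) htop b hb
    have hsum := congrArg (wt ν) hab
    simp only [wt_add] at hsum
    have ha' : a = g := hG.eq_of_le ha (by linarith)
    refine ⟨ha', ?_⟩
    rw [ha'] at hab
    exact add_left_cancel hab
  have hB : coeff (γ₀ + g + e) (F * jac G v) = coeff γ₀ F * (coeff g G * coeff e v * ((idet g e : ℤ) : ℂ)) := by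
    rw [show γ₀ + g + e = γ₀ + (g + e) from add_assoc _ _ _]
    rw [coeff_mul_of_unique F (jac G v) γ₀ (g + e) ?_, coeff_jac_top ν G v e g hlead hG.1 hG.le]
    intro a ha b hb hab
    have hwa := htop a ha
    have hwb := wt_le_of_mem_support_jac_lead hlead G (wt ν g) hG.le b hb
    have hsum := congrArg (wt ν) hab
    simp only [wt_add] at hsum
    have hb' : b = g + e := eq_of_mem_support_jac_top hlead hG hb (by linarith)
    refine ⟨?_, hb'⟩
    rw [hb'] at hab
    exact add_right_cancel hab
  rw [coeff_sub, hA, hB]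
  push_cast
  ring

/-- Two points of equal `ν`-weight on the shifted axis `g + ℝ·e` coincide (that line has direction `e` and `⟨ν,e⟩ ≠ 0`). -/
theorem onLineShift_unique (ν : Fin 2 → ℝ) (e g γ₁ γ₂ : Expo) (hwe : wt ν e ≠ 0)
    (hw : wt ν γ₁ = wt ν γ₂) (h1 : OnLineShift γ₁ g e) (h2 : OnLineShift γ₂ g e) : γ₁ = γ₂ := by
  unfold OnLineShift at h1 h2
  have h12 : ((idet γ₁ e : ℤ) : ℝ) = ((idet γ₂ e : ℤ) : ℝ) := by rw [h1, h2]
  simp only [idet, Int.cast_sub, Int.cast_mul, Int.cast_natCast] at h12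
  unfold wt at hw hwe
  -- d = γ₁ − γ₂ :  det(d,e) = 0, ⟨ν,d⟩ = 0  ⇒  ⟨ν,e⟩·d = 0
  have L : (((γ₁ 0 : ℕ) : ℝ) - ((γ₂ 0 : ℕ) : ℝ)) * ((e 1 : ℕ) : ℝ) -
      (((γ₁ 1 : ℕ) : ℝ) - ((γ₂ 1 : ℕ) : ℝ)) * ((e 0 : ℕ) : ℝ) = 0 := by
    linear_combination h12
  have H : ν 0 * (((γ₁ 0 : ℕ) : ℝ) - ((γ₂ 0 : ℕ) : ℝ)) + ν 1 * (((γ₁ 1 : ℕ) : ℝ) - ((γ₂ 1 : ℕ) : ℝ)) = 0 := by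
    linear_combination hw
  have W0 : (ν 0 * ((e 0 : ℕ) : ℝ) + ν 1 * ((e 1 : ℕ) : ℝ)) * (((γ₁ 0 : ℕ) : ℝ) - ((γ₂ 0 : ℕ) : ℝ)) = 0 := by
    linear_combination ((e 0 : ℕ) : ℝ) * H + (ν 1) * L
  have W1 : (ν 0 * ((e 0 : ℕ) : ℝ) + ν 1 * ((e 1 : ℕ) : ℝ)) * (((γ₁ 1 : ℕ) : ℝ) - ((γ₂ 1 : ℕ) : ℝ)) = 0 := by
    linear_combination ((e 1 : ℕ) : ℝ) * H - (ν 0) * L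
  have e0 : ((γ₁ 0 : ℕ) : ℝ) = ((γ₂ 0 : ℕ) : ℝ) := by
    have := (mul_eq_zero.mp W0).resolve_left hwe
    linarith
  have e1 : ((γ₁ 1 : ℕ) : ℝ) = ((γ₂ 1 : ℕ) : ℝ) := by
    have := (mul_eq_zero.mp W1).resolve_left hwe
    linarith
  ext i
  fin_cases i
  · exact_mod_cast e0
  · exact_mod_cast e1

/-- ★★ **THE SHIFTED AXIAL TRANSFER in the kernel** (`ShiftedAxialTransfer`). -/
theorem shiftedAxialTransfer : ShiftedAxialTransfer := by
  intro ν F G v e g hF hlead hG hedge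
  have hwe : wt ν e ≠ 0 := hlead.2.2.1
  obtain ⟨p, hp, q, hq, hpq, hpmax, hwq⟩ := hedge
  by_cases hax : ∃ γ₁ ∈ F.support, ∃ γ₂ ∈ F.support,
      γ₁ ≠ γ₂ ∧ wt ν γ₁ = wt ν p ∧ wt ν γ₂ = wt ν p ∧ ¬ OnLineShift γ₁ g e ∧ ¬ OnLineShift γ₂ g e
  · -- Case A: two top points off the shifted axis ⇒ an edge of `G·J(F,v) − F·J(G,v)` in direction ν
    right
    obtain ⟨γ₁, h1, γ₂, h2, hne, hw1, hw2, hna1, hna2⟩ := hax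
    have top1 : ∀ r ∈ F.support, wt ν r ≤ wt ν γ₁ := fun r hr => hw1 ▸ hpmax r hr
    have top2 : ∀ r ∈ F.support, wt ν r ≤ wt ν γ₂ := fun r hr => hw2 ▸ hpmax r hr
    have mem : ∀ γ ∈ F.support, (∀ r ∈ F.support, wt ν r ≤ wt ν γ) → ¬ OnLineShift γ g e →
        γ + g + e ∈ (G * jac F v - F * jac G v).support := by
      intro γ hγ htop hna
      rw [MvPolynomial.mem_support_iff, coeff_shift_top hlead hG hγ htop]
      refine mul_ne_zero (mul_ne_zero (mul_ne_zero ?_ ?_) ?_) ?_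
      · exact MvPolynomial.mem_support_iff.mp hγ
      · exact MvPolynomial.mem_support_iff.mp hG.1
      · exact MvPolynomial.mem_support_iff.mp hlead.1
      · rw [Int.cast_ne_zero, sub_ne_zero]
        exact hna
    refine ⟨γ₁ + g + e, mem γ₁ h1 top1 hna1, γ₂ + g + e, mem γ₂ h2 top2 hna2, ?_, ?_, ?_⟩
    · intro h
      exact hne (add_right_cancel (add_right_cancel h))
    · intro r hr
      have := wt_le_of_mem_support_shift hlead hG top1 r hr
      rw [wt_add, wt_add]
      exact this
    · simp only [wt_add, hw1, hw2]
  · -- Case B: at most one top point off the shifted axis ⇒ ν is (e,g)-shift-special for F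
    left
    push Not at hax
    have uniq : ∀ γ₁ γ₂ : Expo, wt ν γ₁ = wt ν p → wt ν γ₂ = wt ν p →
        OnLineShift γ₁ g e → OnLineShift γ₂ g e → γ₁ = γ₂ :=
      fun γ₁ γ₂ hw1 hw2 hl1 hl2 => onLineShift_unique ν e g γ₁ γ₂ hwe (hw1.trans hw2.symm) hl1 hl2
    refine ⟨p, hp, q, hq, hpq, hpmax, hwq, ?_, ?_⟩
    · intro r hr hwr
      by_contra hnot
      push Not at hnot
      obtain ⟨hrp, hrq⟩ := hnot
      by_cases hpa : OnLineShift p g e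
      · have hqa : ¬ OnLineShift q g e := fun h => hpq (uniq p q rfl hwq hpa h)
        have hra : ¬ OnLineShift r g e := fun h => hrp (uniq r p hwr rfl h hpa)
        exact hra (hax q hq r hr (fun h => hrq h.symm) hwq hwr hqa)
      · have hqa : OnLineShift q g e := hax p hp q hq hpq rfl hwq hpa
        have hra : OnLineShift r g e := hax p hp r hr (fun h => hrp h.symm) rfl hwr hpa
        exact hrq (uniq r q hwr hwq hra hqa)
    · by_contra hno
      push Not at hno
      exact hno.2 (hax p hp q hq hpq rfl hwq hno.1)

/-- Sanity: `G = 1`, `g = 0` recovers ✓ `AxialTransfer`'s conclusion (`1·J(F,v) − F·J(1,v) = J(F,v)`, `IsSpecialShift … e 0 = IsSpecial … e`). [folklore] -/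
theorem axialTransfer_of_shifted (ν : Fin 2 → ℝ) (F v : Poly2) (e : Expo) (hF : F ≠ 0) (hlead : IsAxialLead ν v e)
    (hedge : IsEdgeDir ν F) : IsSpecial ν F e ∨ IsEdgeDir ν (jac F v) := by
  have h1 : IsUniqueTop ν (1 : Poly2) 0 := by
    refine ⟨by rw [MvPolynomial.support_one]; exact Finset.mem_singleton_self _, fun s hs hs0 => ?_⟩
    rw [MvPolynomial.support_one, Finset.mem_singleton] at hs
    exact absurd hs hs0
  have hJ1 : jac (1 : Poly2) v = 0 := by rw [← jacDer_apply, (jacDer v).map_one_eq_zero]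
  have h := shiftedAxialTransfer ν F 1 v e 0 hF hlead h1 hedge
  rw [isSpecialShift_zero_iff, hJ1, mul_zero, sub_zero, one_mul] at h
  exact h

end TowerKernel

end Summit.ValiantsHypothesis.ValiantsHypothesis.Theorems.TwoProducts.RankTwoJacobian

end
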